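import Mathlib
import HarnessLib
import HarnessLib.Audit
import Summits.NavierStokesRegularity.Statement
import Literature.Analysis.FluidPDE.ClassicalSolution
import Literature.Analysis.FluidPDE.LerayHopf
import Literature.Analysis.FluidPDE.NSWave0
import Literature.Analysis.FluidPDE.VectorCalculus
import Literature.Analysis.FluidPDE.AxisymmetricEuler
import Summits.NavierStokesRegularity.NavierStokesRegularity.Theorems.TypeICertificateLadderNoBlowupToClay
import Summits.NavierStokesRegularity.NavierStokesRegularity.Theorems.MonotoneCriticalL3Closure
import HarnessLib.Audit.Status.Attr

/-!
Route: QuasipotentialCoercivity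

DORMANT since 2026-09-01T21:29:06Z (reconciler: no traction for 5 d (last activity statement-closed at 2026-08-27T20:30:28Z); parked, not closed — `ledger route dormant route-NavierStokesRegularity-QuasipotentialCoercivity --off` to rea) — unstaffed, not closed; items shared with open routes are served there. `ledger route dormant <id> --off` reactivates.

# Route QuasipotentialCoercivity — NavierStokesRegularity (Clay A), positive side. Realises idea
card quasipotential-lyapunov (Freidlin–Wentzell quasipotential as a free Lyapunov functional;
enstrophy minus optimal cumulative stretching), CORRECTED FOR SCALING (finite horizon). Rev 2
(route-repair 2026-08-15): the DECIDING chain runs at the enstrophy level and rests on no unproved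
literature fact; the L³ statement stays as the weaker companion crux. Rev 3 (route-repair
2026-08-16, file rev 6): the deciding theorem is CRUX-ONLY — `closes (hZ :
ActionCoercivityEnstrophy) : NavierStokesRegularity`, with reachability and the H¹ continuation
PROVED INLINE; X alone decides Clay (A).

## Thesis X ("it suffices to show")
The FINITE-HORIZON MINIMUM ACTION of forced classical Navier–Stokes from rest — the
Freidlin–Wentzell finite-time quasipotential with identity noise covariance, in control form
V_{ν,τ}(x) = inf { ∫∫|g|² dx dt : (w,q,g) classical on ℝ³×[0,T₀], w uniformly Schwartz, w(0) = 0,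
∂ₜw + (w·∇)w = νΔw − ∇q + g, then an UNFORCED classical Leray–Hopf stretch of length T₁, T₀ + T₁ ≤
τ, ending at x } — is COERCIVE AT THE ENSTROPHY LEVEL: for every ν > 0, horizon τ > 0 and action
level a there is C(ν,τ,a) with ∫|∇x|²_F ≤ C for every state x so reachable ("bounded action in
bounded time cannot buy unbounded enstrophy"; decl ActionCoercivityEnstrophy, the load-bearing
crux). Because an unforced tail costs nothing, monotonicity of V along the free flow is built into
the reachable set, and X gives sup_{t<T} ∫|∇u(t)|² ≤ C(ν, 1+T, a(u₀)) for every classical Leray–Hopf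
solution from Schwartz data (reachability by the linear ramp s ↦ s•u₀ on [0,1] followed by the free
flow: PROVED inline in `closes`, Step 1; also filed as support ReachableAlongFlow); continuation
past T is then the CLASSICAL H¹ continuation (Leray 1934 / Prodi–Serrin via the local strong H¹
theory: PROVED inline in `closes`, Step 2, over the proved tree theorems
leray_local_regular_H1_holds, serrin_weak_strong_uniqueness_holds,
IsLerayHopfOn.exists_isLerayHopfOn_restart_Ioo, IsClassicalNSSolutionOn.glue; also filed as support
EnstrophyClosure), and Clay (A) follows by the shared local-theory assembly NoBlowupToClay (=
stmt-NavierStokesRegularity-0055, PROVED, used as NoBlowupToClay_holds). No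
Escauriaza–Seregin–Šverák is needed on this chain. The card's original, scaling-corrected claim —
coercivity ON L³, ‖x‖_{L³} ≤ C(ν,τ,a) on the same reachable set (decl ActionCoercivityL3) — is
strictly weaker (X ⇒ it by support EnstrophyToL3Coercivity: energy ≤ τa is free, then
Gagliardo–Nirenberg) and is kept as the companion crux: the first target for provers and refuters
alike (its refutation kills X too), and the fallback thesis whose own closure is ESS (support
L3Closure = stmt-NavierStokesRegularity-0063, the unproved-XL named fact
hasSmoothExtensionPast_of_eLpNorm_three_bounded — OFF the deciding chain; see KILL CRITERIA).

Lean (elaborates; deciding theorem certified native, rev 6). With Reach ν τ a x := ∃ T₀ T₁ w q g, [0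
< T₀ ∧ IsClassicalNSSolutionOn (Icc 0 T₀) ν g w q ∧ HasUniformRapidDecayOn (Icc 0 T₀) w ∧ w 0 = 0 ∧
∫⁻ s in Icc 0 T₀, eEnergy (g s) ≤ a] ∧ [0 ≤ T₁ ∧ T₀ + T₁ ≤ τ ∧ ∃ T₂ v pv, T₁ < T₂ ∧
IsClassicalNSSolutionOn (Ico 0 T₂) ν 0 v pv ∧ IsLerayHopfOn T₂ ν 0 (w T₀) v ∧ v 0 = w T₀ ∧ v T₁ = x]
(inlined in every item; all predicates in Literature.Analysis.FluidPDE):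
Lean: `X = ActionCoercivityEnstrophy := ∀ ν > 0, ∀ τ > 0, ∀ a : ℝ≥0, ∃ C : ℝ≥0, ∀ x, Reach ν τ a x →
∫⁻ y, ENNReal.ofReal (frobeniusNormSq (fderiv ℝ x y)) ≤ C`

## Assembly X → NavierStokesRegularity
Deciding theorem (route file, rev 6, sorry-free, axioms propext/Classical.choice/Quot.sound,
certified native with hypotheses = [ActionCoercivityEnstrophy]): `theorem closes (hZ :
ActionCoercivityEnstrophy) : NavierStokesRegularity`. Proof (≈190 lines, all over PROVED tree
theorems): apply NoBlowupToClay_holds; fix ν,T,u,p classical on [0,T), Leray–Hopf from u 0,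
HasRapidSpatialDecay (u 0). Step 1 (ex ReachableAlongFlow): the ramp w s = s•u 0 on S = [0,1] with
pressure 0 and force g := ∂ₛw + (w·∇)w − νΔw is a classical forced solution (momentum by definition,
div-free by linearity of the trace), uniformly Schwartz (Leibniz bound norm_iteratedFDeriv_smul_le
for p.1 • u 0 p.2 + HasRapidSpatialDecay), with finite action (‖g s x‖ ≤ K(1+|x|)⁻²,
finite_integral_one_add_norm), and the free tail is u itself; so every slice u t, t < T, is
reachable with horizon T+1 and one action level, and X gives ∫|∇u(t)|²_F ≤ C on [0,T). Step 2 (ex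
EnstrophyClosure): with Leray's regular H¹ solutions (leray_local_regular_H1_holds, lifespan d =
c₀ν³/(A²+1), A = C+1 ≥ ‖∇u(s)‖² since eWeakGradL2Sq = ∫|fderiv|² for smooth slices) restart at a
good time s ∈ (T − d/2, T) (exists_isLerayHopfOn_restart_Ioo), identify u(·+s) with the regular
solution by serrin_weak_strong_uniqueness_holds in L^∞ₜL⁶ₓ, and glue (IsClassicalNSSolutionOn.glue)
to a classical solution on [0, s+d) ⊋ [0,T]. Records: `Assembly` (stmt-1448) = the rev-1 L³ fallback
composition ActionCoercivityL3 → ReachableAlongFlow → L3Closure → NoBlowupToClay →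
NavierStokesRegularity (TRUE by 7 lines of logic; KILL CRITERIA (iii)); `Assembly2` (stmt-3530) =
superseded rev-1 record — the ONLY remaining needs_repair badge (route.multi-assembly) and NOT
fixable with planner verbs (gate refuses --drop / --retriage of assembly-kind items and bounces
every item-set edit on the multi-assembly post-check): OPERATOR clean-up requested (delete or
re-kind stmt-3530). The supports ReachableAlongFlow (1447) and EnstrophyClosure (10592) are no
longer load-bearing; a prover may close each by copying Step 1 / Step 2 out of `closes` (their drop
is blocked by the same post-check).

## Two-layer plan (D-0019)
Layer 1 (ranked cruxes): #2 ActionCoercivityL3 (companion, weakest form of the line: staffed first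
because a proof is the cheapest real progress and a refutation — finite-but-unbounded L³ inflation
at bounded action — kills everything above it); #3 ActionCoercivityEnstrophy (the deciding thesis X;
its unforced part is Tao's a-priori H¹-bound conjecture, Tao2011 Conj. 16/17, equivalent to H¹
global regularity by Tao2011 Thm 20(vi)); #4 AxisymNoSwirlActionCoercivity (#3 in the axisymmetric
swirl-free controlled class — calibration of the functional where unforced regularity is classical
but the printed forced theory needs f ∈ L²ₜH¹ₓ; sub-Clay, numerically falsifiable: refuters' advice
is to staff it early). Support: EnstrophyClosure (H¹ continuation; proved inline in closes Step 2,
optional as an item), ReachableAlongFlow (linear ramp + free tail; proved inline in closes Step 1,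
optional), NoBlowupToClay (shared 0055), EnstrophyToL3Coercivity (#3 ⇒ #2: interpolation + energy ≤
τa; Iff.rfl-shaped glue), TwoDimensionalActionBound (ν∫|∇w(T₀)|² ≤ ∫∫|g|² on ℝ²: the
Brzeźniak–Cerrai–Freidlin identity 'quasipotential = enstrophy' as the unit test of the
definitions); informal negative companion TaoAveragedCheapEnstrophy; definition request
NSQuasipotential.
Layer 2 (later, glued split of #3/#2 once something closes): existence/regularity of minimum-action
paths (instanton = forward NS ⊕ backward adjoint) and an a-priori STRETCHING BUDGET along extremals,
read off the completed square V(x) = ν‖∇x‖² + inf_paths [ ½∫‖u̇ − νΔu + B(u,u)‖² − 2ν∫∫ω·Sω ]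
("ν·enstrophy minus the cheapest cumulative vortex stretching").

Rationale: WHY THIS LINE. Every positive strategy wants a coercive monotone quantity at the critical level
(Tao2007WhyNSHard Strategy 2; route MonotoneCritical posited the bare interface and was closed as
superseded by this route). Large-deviation theory hands one over for free: the Freidlin–Wentzell
quasipotential of NS + small noise is non-increasing along the UNFORCED flow for every covariance
(FreidlinWentzell2012 Ch. 4; MFT: BertiniEtAl2015), equals ν×enstrophy in 2-D
(BrzezniakCerraiFreidlin2015 Thm 7.1, via ⟨B(u,u),Au⟩ = 0), and in 3-D completing the square gives
V(x) = ν‖∇x‖² + inf_paths[½∫‖u̇ − νΔu + B‖² − 2ν∫∫ω·Sω] (⟨(u·∇)u, Δu⟩ = ∫ω·Sω on ℝ³): ENSTROPHY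
MINUS THE CHEAPEST CUMULATIVE STRETCHING a controlled path can harvest. Its control form
(QuastelYau1998's LDP rate functional is the H⁻¹ twin) needs no probability. Imported: large
deviations / optimal control (object, monotonicity, instantons), minimum-action numerics
(SchorleppEtAl2022) as falsification practice. REV 2 (route-repair 2026-08-15): the functional has
the dimension of enstrophy and all of the route's instrumentation (2-D identity, swirl-free
calibration, Tao-averaged companion, layer-2 completed square) lives at the enstrophy level, so the
deciding chain is drawn there: X = ActionCoercivityEnstrophy, closed by the classical H¹
continuation (EnstrophyClosure, provable now over leray_local_strong_H1_holds /
tao2011_H1_local_almost_regular_holds / serrin_weak_strong_uniqueness_holds) — no unproved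
literature fact (ESS) on the critical path; the L³ form ActionCoercivityL3 is kept as the weaker
companion. REV 3 (route-repair 2026-08-16): that glue is now PROVED inside the deciding theorem —
`closes (hZ : ActionCoercivityEnstrophy) : NavierStokesRegularity` is crux-only (reachability ramp +
Leray H¹ restart/Serrin uniqueness/glue + NoBlowupToClay_holds, ≈190 lines over proved tree
theorems).
CORRECTION OF THE CARD (numbers). Action has NS dimension λ¹ like enstrophy ([A] = L⁵T⁻³; A/ν³ and
Z/ν² ~ 1/L) while L³ is λ⁰: the card's scale-free claim "{V ≤ c} bounded in L³" is FALSE on ℝ³ by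
dilation — large scales are cheap (ramp cost ≈ A²L³/T + A⁴LT + ν²A²T/L → 0 along L → ∞ at fixed
L³-size AL). Repair: FINITE HORIZON. Along Schwartz paths d‖w‖₂/dt ≤ ‖g‖₂, so ∫∫|g|² ≥ ‖x‖₂²/τ kills
the loophole; the one dimensionless group is a·τ^{1/2}·ν^{−5/2}; energy never needs mentioning (E ≤
τa on the reachable set). Junction smoothness (forced path ⊕ free flow is not C^∞ in t) is bypassed
by the TWO-PIECE reachable set, which makes monotonicity definitional and the deciding theorem
elementary (closes, rev 6); parasitic pressure-driven solutions are excluded by Schwartz decay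
(forced piece) and Leray–Hopf (tail).
RANKED CRUXES. #2 ActionCoercivityL3 — the companion and weakest form of the line (rank 2 = most
informative: its refutation kills #3 and the route, its proof is the cheapest real progress and
closes Clay modulo ESS); in strength a quantitative regularity theorem for NS forced in an
L²ₜL²ₓ-ball, uniform over the ball (its f = 0 tail is of the kind Tao2011 Thm 20 shows equivalent to
H¹-global regularity); can fail by finite-but-unbounded L³ inflation with no blow-up at all. #3
ActionCoercivityEnstrophy — the deciding thesis X (the ONLY hypothesis of `closes`); stronger and
the cleaner refuter target (thin vortex SHEETS carry enstrophy at bounded velocity); phenomenology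
is on its side (νZ_peak ≲ injection rate; ring-expansion attack: ω_θ ∝ r needs energy Γ²R fed within
τ at cost ≳ Γ²R/τ, and viscous core thickening δ ~ √(νt) restores Z ≲ 2a/ν; thinning a sheet to δ ~
√(ν/σ) needs strain σ maintained at bounded cost). #4 AxisymNoSwirlActionCoercivity — calibration
where unforced regularity is classical; the printed forced theory needs f ∈ L²ₜH¹ₓ
(LemarieRieusset2016 Thm 10.4) while the action gives L²ₜL²ₓ, so the source (curl g)_θ/r of ω_θ/r is
uncontrolled at the axis: open as a UNIFORM bound, expected true; sub-Clay and numerically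
falsifiable (head-on vortex-ring collision is the sharpest swirl-free enstrophy burst) — staff
early.
KILL CRITERIA. (i) a bounded-action family at fixed (ν,τ,a) with ‖x_n‖_{L³} → ∞ refutes #2, hence
#3, and closes the route as "functional too weak" — cheapest probe: minimum-action numerics
(SchorleppEtAl2022 set-up), targets = one intense profile rescaled to scale λ: action SATURATING as
λ → 0 is death, growth ~ λ⁻¹ is life; (ii) #4 refuted ⇒ close (cheap enstrophy without any
singularity mechanism refutes #3 in its easiest sector and discredits #2); (iii) #3 refuted with #2
alive (bounded L³, unbounded enstrophy: sheets) ⇒ the route goes BROKEN and is REPAIRED, not closed: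
re-attach the ESS L³ closure stmt-NavierStokesRegularity-0063 and re-glue `closes` through
ActionCoercivityL3 → L3Closure → NoBlowupToClay with the reachability Step 1 of the present `closes`
reused verbatim (energy ≤ τa + Gagliardo–Nirenberg as in EnstrophyToL3Coercivity is not even needed
there) — the route then carries the unproved-XL ESS fact
hasSmoothExtensionPast_of_eLpNorm_three_bounded as explicit debt; (iv) blow-up (routes Blowup /
CertifiedBlowup) kills every positive route; NoBlowup proved elsewhere moots this one.
NOT DECOMPOSED YET (deliberately). The minimiser layer (existence of optimal paths,
Pontryagin/instanton system, stretching budget along extremals) = layer-2 children of #3/#2;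
degenerate/low-mode covariances Q (finiteness = exact controllability, only approximate in 3-D:
KuksinShirikyan2012) — not filed; the Tao-averaged negative companion stays informal until a
forced-mild predicate for B̃ exists; no Target item (X is literally crux #3). D-0027: the crux-only
deciding theorem `closes (hZ : ActionCoercivityEnstrophy)` is what decides (rev 6); the rev-1
assembly-kind items stay as records only (Assembly = the L³ fallback composition, provable by logic
now; Assembly2 = the superseded rev-1 filing of the H¹ closure) because a planner can neither drop
nor re-kind an assembly-kind entry — operator clean-up of stmt-3530 requested (only remaining badge:
route.multi-assembly).
CHEAPEST FALSIFIER. Minimum-action numerics at fixed (ν,τ): the cost a(Z) of reaching enstrophy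
level Z (resp. a(λ) of reaching one intense profile rescaled to scale λ) in the SchorleppEtAl2022
instanton set-up — a SATURATING a(Z) as Z → ∞ (or a(λ) as λ → 0) kills #3 (resp. #2 and the route);
linear growth a ~ νZ/2 (the 2-D/direct-injection rate) or a ~ ν³/λ is life. Cheaper still, on paper:
the swirl-free ring-collision family of #4 (explicit Γ, R, δ bookkeeping) — if near-axis forcing
buys η = ω_θ/r growth at bounded ∫∫|g|², #4 dies first.
Items after rev 6: 3 cruxes (1442–1444); support ReachableAlongFlow 1447 and EnstrophyClosure 10592
(both proved inline in closes; optional as items), EnstrophyToL3Coercivity 1445,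
TwoDimensionalActionBound 1446, NoBlowupToClay 0055 (shared, PROVED), L3Closure 0063 (shared, ESS,
off-chain); records Assembly 1448 / Assembly2 3530; informal companion 1468; definitions landed
(Literature.Analysis.FluidPDE.NSQuasipotential). Deciding theorem `closes (hZ :
ActionCoercivityEnstrophy) : NavierStokesRegularity` certified crux-only (rev 6).

Novelty: NOVELTY. Nearest prior art: BrzezniakCerraiFreidlin2015 (arXiv:1401.6299) Thm 7.1 — 2-D torus,
quasipotential = enstrophy, exit times, no 3-D and no regularity use; QuastelYau1998 — the NS
forcing-action is a rigorous LDP rate functional (hydrodynamic limit), no Lyapunov use;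
SchorleppEtAl2022 — numerical Freidlin–Wentzell minimisers of forced 3-D NS conditioned on extreme
pointwise vorticity/strain (the falsification toolchain); FreidlinWentzell2012 Ch. 4 —
quasipotential decreases along the unperturbed flow (finite dimensions).
Delta: (1) deterministic use of the FINITE-TIME quasipotential (minimum control action from rest) as
a Lyapunov functional for the 3-D regularity problem, with COERCIVITY ON L³ as the thesis and ESS as
the closing fact; (2) the scaling analysis: the scale-free version is false on ℝ³ by dilation and
the HORIZON (not the energy) is the repairing parameter, dimensionless group aτ^{1/2}ν^{-5/2}; (3)
the two-piece reachable set that makes monotonicity definitional and the Clay assembly pure logic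
over in-tree predicates (IsClassicalNSSolutionOn with forcing, HasUniformRapidDecayOn,
IsLerayHopfOn); (4) the enstrophy-level and swirl-free calibration cruxes tying the functional to
Tao2011's quantitative-regularity equivalences and to the Ukhovskii–Yudovich class with only L²ₜL²ₓ
forcing; (5) the 3-D completed square "ν·enstrophy minus cheapest cumulative stretching" as the
layer-2 programme. Expected grade: new-combination (the card was audited twice as such  [refs: 1401.6299, 2604.22461, 1108.1165, 2107.06153, arxiv:1108.1165, arxiv:2107.06153, BrzezniakCerraiFreidlin2015, QuastelYau1998, SchorleppEtAl2022, FreidlinWentzell2012, Tao2011, BertiniEtAl2015]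

Barriers (technique_class: ld-quasipotential minimum-action optimal-control): technique_class: ld-quasipotential minimum-action optimal-control
- Literature.Barriers.NavierStokesRegularity.TaoAveragedBlowup: NOT evaded by construction, and the
route says so: the action functional, its monotonicity and ReachableAlongFlow exist verbatim for
Tao's averaged B̃, and Tao2016AveragedNS Thm 1.5 with the H¹ blow-up criterion for B̃ makes the
enstrophy crux #3 FALSE for B̃ (informal companion TaoAveragedCheapEnstrophy). Hence every proof of
#2/#3 must use B-specific structure, which the completed square localises in the sign/geometry of
∫ω·Sω with the exact Biot–Savart strain along near-optimal paths; a Type-II cascade is precisely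
"cheap stretching".
- Literature.Barriers.NavierStokesRegularity.EnergySupercriticality: met head-on in dimension
(action ~ λ¹, like enstrophy): scale-free coercivity is false by dilation; the line evades only
through the horizon τ (ντ is a length², ∫∫|g|² ≥ ‖x‖₂²/τ), i.e. it claims a NEW controlled quantity
rather than an energy-class estimate across scales; the bet is the variational structure (minimisers
solve forward NS ⊕ backward adjoint), not harmonic analysis of B.
- Literature.Barriers.NavierStokesRegularity.CriticalNormBlowupNecessity: consistent — the route
bounds exactly the norm (L³) whose divergence is necessary at blow-up; closure = ESS (shared
stmt-0063). Literature.Barriers.NavierStokesRegularity.CriticalBesovNormInflation: coercivity is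
asked in L³ (and H¹), never in Ḃ^{-1}_{∞,∞}; no conflict.
- Literature.Barriers.Na

Novelty grade: new-combination — THIRD ROUTE REVIEW + grade (refuter e9ea9d76, 2026-08-15; concurs with ab1e3435/116ebd40: new-combination). Live zbMATH 'quasi-potential Navier-Stokes' (9 rows) + arXiv: every quasipotential/LDP paper for NS is 2-D STOCHASTIC (BCF 2015, Brzeźniak–Cerrai 2017, Cerrai–Paskal 2022, Liu–Tang–Zhang 2026) (refuter refuter-rreview-route-AnomalousDissipati-e9ea9d76-0, 2026-08-15T13:52:42Z; prior: BrzezniakCerraiFreidlin2015 arXiv:1401.6299 Thm 7.1 (2-D torus: quasipotential = ν·enstrophy), FreidlinWentzell2012 Ch. 4 (monotonicity along the free flow), QuastelYau1998 (NS forcing-action as LDP rate functional), SchorleppEtAl2022 arXiv:2107.06153 (minimum-action numerics, 3-D NS), Tao2011 arXiv:1108.1165 Thm 20 / Conj. 16 (strength calibration), EscauriazaSereginSverak2003 / Seregin2012 (L³ c)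

History (route lifecycle, newest last):
- 2026-08-16T14:43:06Z · LINT AUTOFIX route.multi-assembly: kept Assembly, dropped Assembly2 (gate:hygiene)
- 2026-08-23T03:13:45Z · DORMANT — reconciler: no traction for 5.9 d (last activity statement-grounded at 2026-08-17T05:49:56Z); parked, not closed — `ledger route dormant route-NavierStokesRegul (operator:999:1832784)
- 2026-08-27T04:05:42Z · REACTIVATED — reconciler: reactivated — activity item-proof-filed at 2026-08-27T02:48:33Z after parking at 2026-08-23T03:13:45Z (operator:999:1467396)
- 2026-09-01T21:29:06Z · DORMANT — reconciler: no traction for 5 d (last activity statement-closed at 2026-08-27T20:30:28Z); parked, not closed — `ledger route dormant route-NavierStokesRegularit (operator:999:2702528)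

sub-problem: NavierStokesRegularity · status: dormant · opened planner-plancard-NavierStokesRegularity-Navie-98f70ba4-0 2026-08-15T10:56:08Z · rev 10 · ledger route-NavierStokesRegularity-QuasipotentialCoercivity
GENERATED by the gate from the ledger (D-0016/17). Provers cite these decls: `theorem foo : Summit.NavierStokesRegularity.NavierStokesRegularity.Theses.QuasipotentialCoercivity.<Decl> := …` in Summits/NavierStokesRegularity/NavierStokesRegularity/Theorems/<Name>.lean.
-/

namespace Summit.NavierStokesRegularity.NavierStokesRegularity.Theses.QuasipotentialCoercivity

open scoped BigOperators Topology Manifold Classical MeasureTheory ProbabilityTheory Matrix InnerProductSpace ComplexConjugate ContinuousMap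
open Filter Set Function TopologicalSpace MeasureTheory

attribute [summit_statement] _root_.NavierStokesRegularity

open Literature.NS

/-- item stmt-NavierStokesRegularity-1442 · crux · rank 2 · open · by planner
why it might fail: NSR-strength (its free tail ⊇ a uniform Tao2011-Thm-20-type bound, so any blow-up kills it) and refutable WITHOUT blow-up: finite-but-unbounded L³ inflation at fixed (ν,τ,a) when a²τ ≳ ν⁵ — cheap thin tubes via driven reconnection/instanton paths; only a²τ ≪ ν⁵ is safe (Z ≤ a/ν, Grönwall).
sources: Tao2011, BrzezniakCerraiFreidlin2015, FreidlinWentzell2012, SchorleppEtAl2022, QuastelYau1998, Seregin2012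
[crux] THESIS X (card quasipotential-lyapunov, scaling-corrected). The finite-horizon minimum action
(Freidlin–Wentzell finite-time quasipotential, identity covariance, control form) is COERCIVE ON L³:
for every ν>0, τ>0 and action level a there is C with ‖x‖_{L³} ≤ C for every x reachable within
total time τ by (i) a classical forced path (w,q,g) from rest, uniformly Schwartz, with ∫₀^{T₀}∫|g|²
≤ a, then (ii) an initial segment [0,T₁] of a classical Leray–Hopf UNFORCED solution from w(T₀) (the
free tail costs nothing: the Lyapunov property of the quasipotential made definitional). Reading:
near-singular states are not reachable from rest at bounded cost in bounded time — forcing scale ℓ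
directly costs action of dimension λ¹ (~ν³/ℓ), large scales are excluded by ∫∫|g|² ≥ ‖x‖₂²/τ, so
only the nonlinearity could subsidise them. Dimensionless: ‖x‖₃/ν ≤ G(aτ^{1/2}ν^{-5/2}). The f=0
part is a quantitative regularity statement of the type Tao2011 Thm 20 shows equivalent to H¹ global
regularity; the forced part is its L²ₜL²ₓ-forcing twin. Layer-2 plan (not filed): minimisers exist
and solve the instanton system (forward NS ⊕ backward adjoint, SchorleppEtAl2022 §2.2); completed
square V = -/
@[route_item "route-NavierStokesRegularity-QuasipotentialCoercivity"]
def ActionCoercivityL3 : Prop :=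
  ∀ ν : ℝ, 0 < ν → ∀ τ : ℝ, 0 < τ → ∀ a : NNReal, ∃ C : NNReal, ∀ x : EuclideanSpace ℝ (Fin 3) → EuclideanSpace ℝ (Fin 3), (∃ (T₀ T₁ : ℝ) (w : ℝ → EuclideanSpace ℝ (Fin 3) → EuclideanSpace ℝ (Fin 3)) (q : ℝ → EuclideanSpace ℝ (Fin 3) → ℝ) (g : ℝ → EuclideanSpace ℝ (Fin 3) → EuclideanSpace ℝ (Fin 3)), (0 < T₀ ∧ Literature.Analysis.FluidPDE.IsClassicalNSSolutionOn (Set.Icc 0 T₀) ν g w q ∧ Literature.Analysis.FluidPDE.HasUniformRapidDecayOn (Set.Icc 0 T₀) w ∧ w 0 = 0 ∧ (∫⁻ s in Set.Icc 0 T₀, Literature.Analysis.FluidPDE.eEnergy (g s)) ≤ (a : ENNReal)) ∧ (0 ≤ T₁ ∧ T₀ + T₁ ≤ τ ∧ ∃ (T₂ : ℝ) (v : ℝ → EuclideanSpace ℝ (Fin 3) → EuclideanSpace ℝ (Fin 3)) (pv : ℝ → EuclideanSpace ℝ (Fin 3) → ℝ), T₁ < T₂ ∧ Literature.Analysis.FluidPDE.IsClassicalNSSolutionOn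 (Set.Ico 0 T₂) ν 0 v pv ∧ Literature.Analysis.FluidPDE.IsLerayHopfOn T₂ ν 0 (w T₀) v ∧ v 0 = w T₀ ∧ v T₁ = x)) → MeasureTheory.eLpNorm x 3 MeasureTheory.volume ≤ (C : ENNReal)

/-- item stmt-NavierStokesRegularity-1443 · crux · rank 3 · open · by planner
why it might fail: Stronger than #2; unforced tail = Tao2011 Conj. 16 (a-priori H¹ bound ⇔ global regularity, Thm 20), open. Forced failure mode: sheets/expanding rings carry large enstrophy at bounded velocity; if strain-driven thinning is buyable at bounded action faster than viscous thickening δ~√(νt), Z is cheap.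
sources: Tao2011, DoeringGibbon1995, arXiv:1909.00041, doi:10.1512/iumj.2008.57.3716, SchorleppEtAl2022, BrzezniakCerraiFreidlin2015
[crux] ENSTROPHY-LEVEL COERCIVITY ('bounded action in bounded time cannot buy unbounded enstrophy'):
same reachable set, conclusion ∫|∇x|²_F ≤ C(ν,τ,a). Implies ActionCoercivityL3 via support
EnstrophyToL3Coercivity (‖x‖₃⁴ ≲ ‖x‖₂²‖∇x‖₂², ‖x‖₂² ≤ τa). Mechanism: along a forced Schwartz path
ν‖∇w(T₀)‖² = ∫∫|Pg|² − R + 2ν∫∫ω·Sω (completed square; R ≥ 0 the time-reversed residual), so the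
claim is exactly a bound on the cumulative vortex stretching harvestable at bounded cost; in 2-D the
stretching term is absent and the bound is support item TwoDimensionalActionBound. The unforced
(tail) part is Tao2011 Conjecture 16 (a-priori bound ‖u‖_{L^∞H¹} ≤ F(‖u₀‖_{H¹},T₀)), equivalent to
H¹-global regularity (Tao2011 Thm 20(vi)). Planner sanity estimates (NOTES.md): direct injection
gives Z ≲ a/ν; vortex-ring expansion (ω_θ ∝ r) needs energy Γ²R fed within τ at cost ≳ Γ²R/τ and
viscous core thickening δ ~ √(νt) restores Z ≲ 2a/ν. First numerical falsifier: minimum action to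
reach enstrophy level Z at fixed (ν,τ) — unbounded in Z or not? -/
@[route_item "route-NavierStokesRegularity-QuasipotentialCoercivity", crux]
def ActionCoercivityEnstrophy : Prop :=
  ∀ ν : ℝ, 0 < ν → ∀ τ : ℝ, 0 < τ → ∀ a : NNReal, ∃ C : NNReal, ∀ x : EuclideanSpace ℝ (Fin 3) → EuclideanSpace ℝ (Fin 3), (∃ (T₀ T₁ : ℝ) (w : ℝ → EuclideanSpace ℝ (Fin 3) → EuclideanSpace ℝ (Fin 3)) (q : ℝ → EuclideanSpace ℝ (Fin 3) → ℝ) (g : ℝ → EuclideanSpace ℝ (Fin 3) → EuclideanSpace ℝ (Fin 3)), (0 < T₀ ∧ Literature.Analysis.FluidPDE.IsClassicalNSSolutionOn (Set.Icc 0 T₀) ν g w q ∧ Literature.Analysis.FluidPDE.HasUniformRapidDecayOn (Set.Icc 0 T₀) w ∧ w 0 = 0 ∧ (∫⁻ s in Set.Icc 0 T₀, Literature.Analysis.FluidPDE.eEnergy (g s)) ≤ (a : ENNReal)) ∧ (0 ≤ T₁ ∧ T₀ + T₁ ≤ τ ∧ ∃ (T₂ : ℝ) (v : ℝ → EuclideanSpace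 ℝ (Fin 3) → EuclideanSpace ℝ (Fin 3)) (pv : ℝ → EuclideanSpace ℝ (Fin 3) → ℝ), T₁ < T₂ ∧ Literature.Analysis.FluidPDE.IsClassicalNSSolutionOn (Set.Ico 0 T₂) ν 0 v pv ∧ Literature.Analysis.FluidPDE.IsLerayHopfOn T₂ ν 0 (w T₀) v ∧ v 0 = w T₀ ∧ v T₁ = x)) → (∫⁻ y, ENNReal.ofReal (Literature.Analysis.FluidPDE.frobeniusNormSq (fderiv ℝ x y))) ≤ (C : ENNReal)

/-- item stmt-NavierStokesRegularity-1444 · crux · rank 4 · open · by planner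
why it might fail: Free tail is routine (H¹→H² smoothing + Ladyzhenskaya Grönwall, in-tree axisymmetricNoSwirl_enstrophy_apriori); FORCED piece open: L²ₜL²ₓ action does not control the source (curl g)_θ/r of η=ω_θ/r (print: f∈L²H¹, LR2016 Thm 10.4; Abidi L²H^{1/4+ε}); near-axis injection + ring expansion may win.
sources: LemarieRieusset2016, doi:10.1016/j.bulsci.2007.10.001, MajdaBertozzi2002, KNSS2009, Tao2011, Literature.Analysis.FluidPDE.axisymmetricNoSwirl_enstrophy_apriori_holds
[crux] CALIBRATION IN THE SWIRL-FREE AXISYMMETRIC CLASS: ActionCoercivityEnstrophy restricted to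
forced pieces with w(s), g(s) axisymmetric about the x₂-axis and swirl-free (in-tree IsAxisymmetric,
HasNoSwirl) and axisymmetric swirl-free tails. Unforced regularity is classical here (Ladyzhenskaya;
Ukhovskii–Yudovich 1968; in-tree fact axisymmetric_no_swirl_global_regularity) through the maximum
principle for η = ω_θ/r, but the printed forced theory needs f ∈ L²ₜH¹ₓ (LemarieRieusset2016 Thm
10.4) while the action only bounds ∫∫|g|², and the source of η is (curl g)_θ/r — large for cheap
forcing placed at the axis. Expected TRUE (ring-expansion estimate Z ≲ 2a/ν after viscous core
thickening) and a genuine theorem about controlled NS either way: a proof calibrates the functional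
(and is the m=0 sector of any general attack); a refutation kills the route cheaply by exhibiting
cheap enstrophy WITHOUT any singularity mechanism. -/
@[route_item "route-NavierStokesRegularity-QuasipotentialCoercivity"]
def AxisymNoSwirlActionCoercivity : Prop :=
  ∀ ν : ℝ, 0 < ν → ∀ τ : ℝ, 0 < τ → ∀ a : NNReal, ∃ C : NNReal, ∀ x : EuclideanSpace ℝ (Fin 3) → EuclideanSpace ℝ (Fin 3), (∃ (T₀ T₁ : ℝ) (w : ℝ → EuclideanSpace ℝ (Fin 3) → EuclideanSpace ℝ (Fin 3)) (q : ℝ → EuclideanSpace ℝ (Fin 3) → ℝ) (g : ℝ → EuclideanSpace ℝ (Fin 3) → EuclideanSpace ℝ (Fin 3)), (0 < T₀ ∧ Literature.Analysis.FluidPDE.IsClassicalNSSolutionOn (Set.Icc 0 T₀) ν g w q ∧ Literature.Analysis.FluidPDE.HasUniformRapidDecayOn (Set.Icc 0 T₀) w ∧ w 0 = 0 ∧ (∫⁻ s in Set.Icc 0 T₀, Literature.Analysis.FluidPDE.eEnergy (g s)) ≤ (a : ENNReal) ∧ (∀ s ∈ Set.Icc 0 T₀, Literature.Analysis.FluidPDE.IsAxisymmetric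 (w s) ∧ Literature.Analysis.FluidPDE.HasNoSwirl (w s) ∧ Literature.Analysis.FluidPDE.IsAxisymmetric (g s) ∧ Literature.Analysis.FluidPDE.HasNoSwirl (g s))) ∧ (0 ≤ T₁ ∧ T₀ + T₁ ≤ τ ∧ ∃ (T₂ : ℝ) (v : ℝ → EuclideanSpace ℝ (Fin 3) → EuclideanSpace ℝ (Fin 3)) (pv : ℝ → EuclideanSpace ℝ (Fin 3) → ℝ), T₁ < T₂ ∧ Literature.Analysis.FluidPDE.IsClassicalNSSolutionOn (Set.Ico 0 T₂) ν 0 v pv ∧ Literature.Analysis.FluidPDE.IsLerayHopfOn T₂ ν 0 (w T₀) v ∧ v 0 = w T₀ ∧ v T₁ = x ∧ (∀ s ∈ Set.Ico 0 T₂, Literature.Analysis.FluidPDE.IsAxisymmetric (v s) ∧ Literature.Analysis.FluidPDE.HasNoSwirl (v s)))) → (∫⁻ y, ENNReal.ofReal (Literature.Analysis.FluidPDE.frobeniusNormSq (fderiv ℝ x y))) ≤ (C : ENNReal)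

/-- item stmt-NavierStokesRegularity-17720 · crux · rank 5 · open · by planner
why it might fail: Its f=0 part is quantitative TYPE-I EXCLUSION (Seregin–Šverák: ⇔ Liouville for scaled-energy-bounded ancient solutions, KNSS2009) — open outside axisymmetry; a Type-I-rate blow-up (non-Leray profile, NRS1996/Tsai1998 only kill self-similar ones) reachable at bounded action refutes it.
sources: SereginSverak2009, KNSS2009, Seregin2007, AlbrittonBarker2019, Tao2011, NecasRuzickaSverak1996
[crux] CHILD I of the Type-I/Type-II split of ActionCoercivityEnstrophy (crux-strategist BC2
redirect, 2026-08-17): TYPE-I EXCLUSION AT BOUNDED COST. ActionCoercivityEnstrophy RESTRICTED to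
admissible paths all of whose slices w(s), s∈[0,T₀], and v(s), s∈[0,T₁], obey the Type-I bound
∫_{B(y,r)}|u|² ≤ M·r (all y, r>0), with C = C(ν,τ,a,M). Type-I control along the whole path is the
only form usable by parabolic theory (ε-regularity, backward uniqueness, blow-up zoom + Liouville);
child II supplies it for every slice because the reachable set is closed under truncation (the
proved glue). Unforced content = QUANTITATIVE TYPE-I EXCLUSION: regularity with an a-priori bound
for Leray–Hopf solutions with sup_t sup_{y,r} r⁻¹∫_{B_r(y)}|u|² ≤ M (Seregin2007 critical Morrey
estimates; SereginSverak2009: Type I ⇔ Liouville for bounded-scaled-energy ancient solutions, proved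
in the axisymmetric class; KNSS2009; AlbrittonBarker2019 local version); quantitative ⇐ qualitative
by Tao2011-Thm-1.20-type compactness. The L²ₜL²ₓ forcing is subcritical under the blow-up zoom
(action(u_λ) = λ·action(u) → 0), so the same Liouville conjecture governs the forced phase. Does not
give Clay (A) alone: a Type-I -/
@[route_item "route-NavierStokesRegularity-QuasipotentialCoercivity"]
def TypeIActionCoercivity : Prop :=
  ∀ ν : ℝ, 0 < ν → ∀ τ : ℝ, 0 < τ → ∀ a : NNReal, ∀ M : NNReal, ∃ C : NNReal, ∀ x : EuclideanSpace ℝ (Fin 3) → EuclideanSpace ℝ (Fin 3), (∃ (T₀ T₁ : ℝ) (w : ℝ → EuclideanSpace ℝ (Fin 3) → EuclideanSpace ℝ (Fin 3)) (q : ℝ → EuclideanSpace ℝ (Fin 3) → ℝ) (g : ℝ → EuclideanSpace ℝ (Fin 3) → EuclideanSpace ℝ (Fin 3)), (0 < T₀ ∧ Literature.Analysis.FluidPDE.IsClassicalNSSolutionOn (Set.Icc 0 T₀) ν g w q ∧ Literature.Analysis.FluidPDE.HasUniformRapidDecayOn (Set.Icc 0 T₀) w ∧ w 0 = 0 ∧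 (∫⁻ s in Set.Icc 0 T₀, Literature.Analysis.FluidPDE.eEnergy (g s)) ≤ (a : ENNReal) ∧ (∀ s ∈ Set.Icc 0 T₀, ∀ (y : EuclideanSpace ℝ (Fin 3)) (r : ℝ), 0 < r → (∫⁻ z in Metric.ball y r, ‖w s z‖ₑ ^ 2) ≤ (M : ENNReal) * ENNReal.ofReal r)) ∧ (0 ≤ T₁ ∧ T₀ + T₁ ≤ τ ∧ ∃ (T₂ : ℝ) (v : ℝ → EuclideanSpace ℝ (Fin 3) → EuclideanSpace ℝ (Fin 3)) (pv : ℝ → EuclideanSpace ℝ (Fin 3) → ℝ), T₁ < T₂ ∧ Literature.Analysis.FluidPDE.IsClassicalNSSolutionOn (Set.Ico 0 T₂) ν 0 v pv ∧ Literature.Analysis.FluidPDE.IsLerayHopfOn T₂ ν 0 (w T₀) v ∧ v 0 = w T₀ ∧ v T₁ = x ∧ (∀ s ∈ Set.Icc 0 T₁, ∀ (y : EuclideanSpace ℝ (Fin 3)) (r : ℝ), 0 < r → (∫⁻ z in Metric.ball y r, ‖v s z‖ₑ ^ 2) ≤ (M : ENNReal) * ENNReal.ofReal r))) → (∫⁻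 y, ENNReal.ofReal (Literature.Analysis.FluidPDE.frobeniusNormSq (fderiv ℝ x y))) ≤ (C : ENNReal)

/-- item stmt-NavierStokesRegularity-17724 · crux · rank 6 · open · by planner
why it might fail: A uniform CRITICAL (Morrey M^{2,1} ⊃ L^{3,∞} ⊃ L³) a-priori bound on the reachable set: open like every uniform critical bound; refuted WITHOUT blow-up if driven reconnection/instanton paths buy energy focusing ∫_{B_r}|x|² ≫ r at action ≤ a when a²τ ≳ ν⁵ (Type-II-like cascade at bounded cost).
sources: CaffarelliKohnNirenberg1982, Seregin2007, NecasRuzickaSverak1996, Tsai1998, Tao2011, SchorleppEtAl2022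
[crux] CHILD II of the Type-I/Type-II split of ActionCoercivityEnstrophy (crux-strategist BC2
redirect, 2026-08-17): TYPE-II EXCLUSION AT BOUNDED COST. For every ν>0, τ>0, a there is M with
∫_{B(y,r)}|x|² ≤ M·r for all y, r>0 and EVERY state x of the reachable set R(ν,τ,a) (same two-piece
reachable set as #2/#3) — a uniform bound of the scale-invariant local kinetic energy (the
Caffarelli–Kohn–Nirenberg / Seregin quantity A at one time; the Morrey M^{2,1} size of reachable
states; [M] = ν²). It caps kinetic-energy CONCENTRATION (every Type-II-like focusing ∫_{B_r}|x|² ≫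
r) but does NOT see Type-I singularities: self-similar-rate profiles are O(|y|⁻¹) ∈ L^{3,∞} ⊂
M^{2,1} (Leray, NecasRuzickaSverak1996, Tsai1998), so II is compatible with Type-I blow-up and is
strictly on the Type-II side of the seam. Implied by #3 (Sobolev ∫_{B_r}|x|² ≤ C‖∇x‖₂²r², energy ≤
τa for r ≥ 1) and by #2 (Hölder ∫_{B_r}|x|² ≤ |B₁|^{1/3}‖x‖₃² r); birth line
(Cruxes/ActionCoercivityEnstrophy/Lines/birth-ScaledEnergyActionBound.lean): uniform weak-L³ bound
on R(ν,τ,a) [open stub] + Lorentz–Hölder on balls by layer cake [provable]. Glue to the parent: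
ScaledEnergyActionBound → TypeIActionCoercivity → ActionCoer -/
@[route_item "route-NavierStokesRegularity-QuasipotentialCoercivity"]
def ScaledEnergyActionBound : Prop :=
  ∀ ν : ℝ, 0 < ν → ∀ τ : ℝ, 0 < τ → ∀ a : NNReal, ∃ M : NNReal, ∀ x : EuclideanSpace ℝ (Fin 3) → EuclideanSpace ℝ (Fin 3), (∃ (T₀ T₁ : ℝ) (w : ℝ → EuclideanSpace ℝ (Fin 3) → EuclideanSpace ℝ (Fin 3)) (q : ℝ → EuclideanSpace ℝ (Fin 3) → ℝ) (g : ℝ → EuclideanSpace ℝ (Fin 3) → EuclideanSpace ℝ (Fin 3)), (0 < T₀ ∧ Literature.Analysis.FluidPDE.IsClassicalNSSolutionOn (Set.Icc 0 T₀) ν g w q ∧ Literature.Analysis.FluidPDE.HasUniformRapidDecayOn (Set.Icc 0 T₀) w ∧ w 0 = 0 ∧ (∫⁻ s in Set.Icc 0 T₀, Literature.Analysis.FluidPDE.eEnergy (g s)) ≤ (a : ENNReal)) ∧ (0 ≤ T₁ ∧ T₀ + T₁ ≤ τ ∧ ∃ (T₂ : ℝ) (v : ℝ → EuclideanSpace ℝ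 (Fin 3) → EuclideanSpace ℝ (Fin 3)) (pv : ℝ → EuclideanSpace ℝ (Fin 3) → ℝ), T₁ < T₂ ∧ Literature.Analysis.FluidPDE.IsClassicalNSSolutionOn (Set.Ico 0 T₂) ν 0 v pv ∧ Literature.Analysis.FluidPDE.IsLerayHopfOn T₂ ν 0 (w T₀) v ∧ v 0 = w T₀ ∧ v T₁ = x)) → ∀ (y : EuclideanSpace ℝ (Fin 3)) (r : ℝ), 0 < r → (∫⁻ z in Metric.ball y r, ‖x z‖ₑ ^ 2) ≤ (M : ENNReal) * ENNReal.ofReal r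

/-- item stmt-NavierStokesRegularity-0055 · support · rank 9 · closed · proved by Summit.NavierStokesRegularity.NavierStokesRegularity.Theorems.typeICertificateLadder_noBlowupToClay_proof @ 8d57e70af7e2 (prover) · by planner
sources: Leray1934, Fefferman2000
Given NoBlowup, build the Clay (A) solution: local finite-energy classical solution for smooth
divergence-free rapidly decaying data (Leray 1934 §III / Fujita–Kato 1964 + LPS smoothing), continue
past every T using NoBlowup, glue by weak–strong uniqueness (Prodi–Serrin), bounded energy from the
energy inequality, and convert with
Literature.Analysis.FluidPDE.isNavierStokesSolution_and_smooth_iff. Blow-up at spatial infinity is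
excluded by CKN ε-regularity applied far out. May take named Literature facts (leray_existence_R3,
ladyzhenskaya_prodi_serrin, weak_strong_uniqueness, fujita_kato_local) as hypotheses if the grounder
so rules. -/
@[route_item "route-NavierStokesRegularity-QuasipotentialCoercivity"]
def NoBlowupToClay : Prop :=
  (∀ (ν T : ℝ), 0 < ν → 0 < T → ∀ (u : ℝ → EuclideanSpace ℝ (Fin 3) → EuclideanSpace ℝ (Fin 3)) (p : ℝ → EuclideanSpace ℝ (Fin 3) → ℝ), Literature.Analysis.FluidPDE.IsClassicalNSSolutionOn (Set.Ico 0 T) ν 0 u p → Literature.Analysis.FluidPDE.IsLerayHopfOn T ν 0 (u 0) u → Literature.Analysis.FluidPDE.HasRapidSpatialDecay (u 0) → Literature.Analysis.FluidPDE.HasSmoothExtensionPast ν 0 u T) → NavierStokesRegularity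

/-- `NoBlowupToClay` holds: proved by `Summit.NavierStokesRegularity.NavierStokesRegularity.Theorems.typeICertificateLadder_noBlowupToClay_proof` @ 8d57e70af7e2. -/
theorem NoBlowupToClay_holds : NoBlowupToClay := _root_.Summit.NavierStokesRegularity.NavierStokesRegularity.Theorems.typeICertificateLadder_noBlowupToClay_proof

/-- item stmt-NavierStokesRegularity-0063 · support · rank 9 · closed · proved by Summit.NavierStokesRegularity.NavierStokesRegularity.Theorems.monotoneCritical_monotoneCriticalL3Closure_proof (prover) · by planner
sources: EscauriazaSereginSverak2003, Seregin2012
Escauriaza–Seregin–Šverák 2003 Thm 1.4 / Seregin 2012 Thm 1.1 in the classical finite-energy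
setting: if sup_{0≤t<T} ‖u(t)‖_{L³} < ∞ then T is not a blow-up time. Expected to follow from the
named facts Literature.Analysis.FluidPDE.ess_endpoint /
Literature.Analysis.FluidPDE.seregin_L3_blowup plus LPS smoothing; grounder may restate with (h :
ess_endpoint). [sources: Seregin2012, Prodi1959, Serrin1963, RobinsonRodrigoSadowski2016] -/
@[route_item "route-NavierStokesRegularity-QuasipotentialCoercivity"]
def L3Closure : Prop :=
  ∀ (ν T : ℝ), 0 < ν → 0 < T → ∀ (u : ℝ → EuclideanSpace ℝ (Fin 3) → EuclideanSpace ℝ (Fin 3)) (p : ℝ → EuclideanSpace ℝ (Fin 3) → ℝ), Literature.Analysis.FluidPDE.IsClassicalNSSolutionOn (Set.Ico 0 T) ν 0 u p → Literature.Analysis.FluidPDE.IsLerayHopfOn T ν 0 (u 0) u → Literature.Analysis.FluidPDE.HasRapidSpatialDecay (u 0) → (⨆ t ∈ Set.Ico 0 T, MeasureTheory.eLpNorm (u t) 3 MeasureTheory.volume) < ⊤ → Literature.Analysis.FluidPDE.HasSmoothExtensionPast ν 0 u T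

/-- `L3Closure` holds: proved by `Summit.NavierStokesRegularity.NavierStokesRegularity.Theorems.monotoneCritical_monotoneCriticalL3Closure_proof`. -/
theorem L3Closure_holds : L3Closure := _root_.Summit.NavierStokesRegularity.NavierStokesRegularity.Theorems.monotoneCritical_monotoneCriticalL3Closure_proof

/-- item stmt-NavierStokesRegularity-10592 · support · rank 9 · closed · proved by Summit.NavierStokesRegularity.NavierStokesRegularity.Theorems.quasipotentialCoercivity_enstrophyClosure_proof (prover) · by planner
[support] H¹-LEVEL CLOSURE — the closing step of the route's deciding chain
ActionCoercivityEnstrophy → ReachableAlongFlow → EnstrophyClosure → NoBlowupToClay →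
NavierStokesRegularity (route-repair 2026-08-15 gen 2; re-filed from
stmt-NavierStokesRegularity-3530, mis-kinded in rev 1, with the UNUSED hypothesis
HasRapidSpatialDecay (u 0) removed — reviewers 116ebd40/e9ea9d76 flagged it unused; the statement is
now the exact H¹ twin of the in-tree fact hasSmoothExtensionPast_of_bounded). Claim: a classical
solution of unforced NS on ℝ³×[0,T), Leray–Hopf on [0,T) from u 0, with sup_{t<T} ∫|∇u(t)|²_F < ∞
(iSup in ℝ≥0∞ over the half-open slab, '< ⊤' = an honest uniform enstrophy bound) extends
classically past T (HasSmoothExtensionPast ν 0 u T). KNOWN (Leray 1934 / Prodi–Serrin via the local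
strong H¹ theory; RobinsonRodrigoSadowski2016 Thms 6.15, 6.10, 8.17, proof of Thm 12.3) and
IN-TREE-PROVABLE over PROVED facts only (grounder g18-4, q=5): leray_local_strong_H1_holds,
tao2011_H1_local_almost_regular_holds (⇒ ladyzhenskaya_prodi_serrin_holds),
serrin_weak_strong_uniqueness_holds, IsLerayHopfOn.exists_isLerayHopfOn_restart_Ioo,
memLqLp_top_six_of_isH1RegularOn_Icc, IsClassicalNSSoluti -/
@[route_item "route-NavierStokesRegularity-QuasipotentialCoercivity"]
def EnstrophyClosure : Prop :=
  ∀ (ν T : ℝ), 0 < ν → 0 < T → ∀ (u : ℝ → EuclideanSpace ℝ (Fin 3) → EuclideanSpace ℝ (Fin 3)) (p : ℝ → EuclideanSpace ℝ (Fin 3) → ℝ), Literature.Analysis.FluidPDE.IsClassicalNSSolutionOn (Set.Ico 0 T) ν 0 u p → Literature.Analysis.FluidPDE.IsLerayHopfOn T ν 0 (u 0) u → (⨆ t ∈ Set.Ico 0 T, ∫⁻ y, ENNReal.ofReal (Literature.Analysis.FluidPDE.frobeniusNormSq (fderiv ℝ (u t) y))) < ⊤ → Literature.Analysis.FluidPDE.HasSmoothExtensionPast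 ν 0 u T

-- `EnstrophyClosure` holds: proved by `Summit.NavierStokesRegularity.NavierStokesRegularity.Theorems.quasipotentialCoercivity_enstrophyClosure_proof` (its module imports this route file, so no `_holds` link can be stated here).

/-- item stmt-NavierStokesRegularity-1445 · support · rank 9 · closed · proved by Summit.NavierStokesRegularity.NavierStokesRegularity.Theorems.quasipotentialCoercivity_enstrophyToL3Coercivity_proof (prover) · by planner
sources: RobinsonRodrigoSadowski2016, LemarieRieusset2016
[support] GLUE #3 ⇒ #2. On the reachable set energy is free: forced Schwartz piece d‖w‖₂/dt ≤ ‖g‖₂,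
so ‖w(T₀)‖₂² ≤ T₀∫∫|g|² ≤ τa (energy identity, in-tree shape
IsClassicalNSSolutionOn.hasDerivWithinAt_kineticEnergy); tail: Leray–Hopf energy inequality with f =
0. Then ‖x‖_{L³} ≤ ‖x‖₂^{1/2}‖x‖₆^{1/2} ≤ C‖x‖₂^{1/2}‖∇x‖₂^{1/2} (Gagliardo–Nirenberg–Sobolev on ℝ³
for smooth H¹ fields, by approximation from the compactly supported case). Routine. -/
@[route_item "route-NavierStokesRegularity-QuasipotentialCoercivity"]
def EnstrophyToL3Coercivity : Prop :=
  (∀ ν : ℝ, 0 < ν → ∀ τ : ℝ, 0 < τ → ∀ a : NNReal, ∃ C : NNReal, ∀ x : EuclideanSpace ℝ (Fin 3) → EuclideanSpace ℝ (Fin 3), (∃ (T₀ T₁ : ℝ) (w : ℝ → EuclideanSpace ℝ (Fin 3) → EuclideanSpace ℝ (Fin 3)) (q : ℝ → EuclideanSpace ℝ (Fin 3) → ℝ) (g : ℝ → EuclideanSpace ℝ (Fin 3) → EuclideanSpace ℝ (Fin 3)), (0 < T₀ ∧ Literature.Analysis.FluidPDE.IsClassicalNSSolutionOn (Set.Icc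 0 T₀) ν g w q ∧ Literature.Analysis.FluidPDE.HasUniformRapidDecayOn (Set.Icc 0 T₀) w ∧ w 0 = 0 ∧ (∫⁻ s in Set.Icc 0 T₀, Literature.Analysis.FluidPDE.eEnergy (g s)) ≤ (a : ENNReal)) ∧ (0 ≤ T₁ ∧ T₀ + T₁ ≤ τ ∧ ∃ (T₂ : ℝ) (v : ℝ → EuclideanSpace ℝ (Fin 3) → EuclideanSpace ℝ (Fin 3)) (pv : ℝ → EuclideanSpace ℝ (Fin 3) → ℝ), T₁ < T₂ ∧ Literature.Analysis.FluidPDE.IsClassicalNSSolutionOn (Set.Ico 0 T₂) ν 0 v pv ∧ Literature.Analysis.FluidPDE.IsLerayHopfOn T₂ ν 0 (w T₀) v ∧ v 0 = w T₀ ∧ v T₁ = x)) → (∫⁻ y, ENNReal.ofReal (Literature.Analysis.FluidPDE.frobeniusNormSq (fderiv ℝ x y))) ≤ (C : ENNReal)) → (∀ ν : ℝ, 0 < ν → ∀ τ : ℝ, 0 < τ → ∀ a : NNReal, ∃ C : NNReal, ∀ x : EuclideanSpace ℝ (Fin 3) → EuclideanSpace ℝ (Fin 3), (∃ (T₀ T₁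 : ℝ) (w : ℝ → EuclideanSpace ℝ (Fin 3) → EuclideanSpace ℝ (Fin 3)) (q : ℝ → EuclideanSpace ℝ (Fin 3) → ℝ) (g : ℝ → EuclideanSpace ℝ (Fin 3) → EuclideanSpace ℝ (Fin 3)), (0 < T₀ ∧ Literature.Analysis.FluidPDE.IsClassicalNSSolutionOn (Set.Icc 0 T₀) ν g w q ∧ Literature.Analysis.FluidPDE.HasUniformRapidDecayOn (Set.Icc 0 T₀) w ∧ w 0 = 0 ∧ (∫⁻ s in Set.Icc 0 T₀, Literature.Analysis.FluidPDE.eEnergy (g s)) ≤ (a : ENNReal)) ∧ (0 ≤ T₁ ∧ T₀ + T₁ ≤ τ ∧ ∃ (T₂ : ℝ) (v : ℝ → EuclideanSpace ℝ (Fin 3) → EuclideanSpace ℝ (Fin 3)) (pv : ℝ → EuclideanSpace ℝ (Fin 3) → ℝ), T₁ < T₂ ∧ Literature.Analysis.FluidPDE.IsClassicalNSSolutionOn (Set.Ico 0 T₂) ν 0 v pv ∧ Literature.Analysis.FluidPDE.IsLerayHopfOn T₂ ν 0 (w T₀) v ∧ v 0 = w T₀ ∧ v T₁ = x)) → MeasureTheory.eLpNorm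 x 3 MeasureTheory.volume ≤ (C : ENNReal))

-- `EnstrophyToL3Coercivity` holds: proved by `Summit.NavierStokesRegularity.NavierStokesRegularity.Theorems.quasipotentialCoercivity_enstrophyToL3Coercivity_proof` (its module imports this route file, so no `_holds` link can be stated here).

/-- item stmt-NavierStokesRegularity-1446 · support · rank 9 · closed · proved by Summit.NavierStokesRegularity.NavierStokesRegularity.Theorems.quasipotentialCoercivity_twoDimensionalActionBound_proof (prover) · by planner
sources: BrzezniakCerraiFreidlin2015, MajdaBertozzi2002
[support] 2-D CALIBRATION / unit test of the definitions (BrzezniakCerraiFreidlin2015 Thm 7.1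
'quasipotential = enstrophy' on 𝕋², here as the easy inequality on ℝ² from rest): for a classical
forced path (w,q,g) on ℝ²×[0,T₀], w uniformly Schwartz, w(0) = 0: ν∫|∇w(T₀)|²_F ≤ ∫₀^{T₀}∫|g|².
Proof: vorticity form is pressure-free, ∂ω + w·∇ω = νΔω + curl g, ½ d/dt‖ω‖² = −ν‖∇ω‖² + ⟨curl g, ω⟩
≤ ‖g‖₂‖∇ω‖₂ − ν‖∇ω‖² ≤ ‖g‖₂²/(4ν) (if ∫∫|g|² = ∞ the claim is trivial; else g(s) ∈ L² for a.e. s and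
the integration by parts against Schwartz ω is licit), and ‖ω‖₂ = ‖∇w‖_F for div-free Schwartz w. No
stretching term in 2-D: the 3-D cruxes are exactly about the term this proof lacks. -/
@[route_item "route-NavierStokesRegularity-QuasipotentialCoercivity"]
def TwoDimensionalActionBound : Prop :=
  ∀ ν : ℝ, 0 < ν → ∀ T₀ : ℝ, 0 < T₀ → ∀ (w : ℝ → EuclideanSpace ℝ (Fin 2) → EuclideanSpace ℝ (Fin 2)) (q : ℝ → EuclideanSpace ℝ (Fin 2) → ℝ) (g : ℝ → EuclideanSpace ℝ (Fin 2) → EuclideanSpace ℝ (Fin 2)), Literature.Analysis.FluidPDE.IsClassicalNSSolutionOn (Set.Icc 0 T₀) ν g w q → Literature.Analysis.FluidPDE.HasUniformRapidDecayOn (Set.Icc 0 T₀) w → w 0 = 0 → ENNReal.ofReal ν * (∫⁻ y, ENNReal.ofReal (Literature.Analysis.FluidPDE.frobeniusNormSq (fderiv ℝ (w T₀) y))) ≤ ∫⁻ s in Set.Icc 0 T₀, Literature.Analysis.FluidPDE.eEnergy (g s)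

-- `TwoDimensionalActionBound` holds: proved by `Summit.NavierStokesRegularity.NavierStokesRegularity.Theorems.quasipotentialCoercivity_twoDimensionalActionBound_proof` (its module imports this route file, so no `_holds` link can be stated here).

/-- item stmt-NavierStokesRegularity-1447 · support · rank 9 · closed · proved by Summit.NavierStokesRegularity.NavierStokesRegularity.Theorems.quasipotentialCoercivity_reachableAlongFlow_proof (prover) · by planner
sources: Fefferman2000, FreidlinWentzell2012
[support] FINITENESS + MONOTONICITY (the 'free Lyapunov' property, made definitional): for a
classical solution u on [0,T) that is Leray–Hopf from a rapidly decaying datum, every slice u(t), t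
∈ [0,T), is reachable with one action a and horizon τ = 1 + T: forced piece w(s) = φ(s)·u(0) on
[0,1] (φ smooth, φ(0) = 0, φ(1) = 1), q = 0, g := ∂ₛw + (w·∇)w − νΔw (uniformly Schwartz because
u(0) is C^∞ with Fefferman decay (4) and divergence-free by the solution's divFree at t = 0;
∫₀¹∫|g|² < ∞); tail (T₂, v, pv) := (T, u, p) itself with T₁ = t (t = 0 uses no evolution). Needs:
Schwartz ⇒ L² for g, IsClassicalNSSolutionOn of the explicit ramp on Icc 0 1 (one-sided time
derivatives), HasUniformRapidDecayOn of the ramp. Routine. -/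
@[route_item "route-NavierStokesRegularity-QuasipotentialCoercivity"]
def ReachableAlongFlow : Prop :=
  ∀ (ν T : ℝ), 0 < ν → 0 < T → ∀ (u : ℝ → EuclideanSpace ℝ (Fin 3) → EuclideanSpace ℝ (Fin 3)) (p : ℝ → EuclideanSpace ℝ (Fin 3) → ℝ), Literature.Analysis.FluidPDE.IsClassicalNSSolutionOn (Set.Ico 0 T) ν 0 u p → Literature.Analysis.FluidPDE.IsLerayHopfOn T ν 0 (u 0) u → Literature.Analysis.FluidPDE.HasRapidSpatialDecay (u 0) → ∃ (τ : ℝ) (a : NNReal), 0 < τ ∧ ∀ t ∈ Set.Ico 0 T, ∃ (T₀ T₁ : ℝ) (w : ℝ → EuclideanSpace ℝ (Fin 3) → EuclideanSpace ℝ (Fin 3)) (q : ℝ → EuclideanSpace ℝ (Fin 3) → ℝ) (g : ℝ → EuclideanSpace ℝ (Fin 3) → EuclideanSpace ℝ (Fin 3)), (0 < T₀ ∧ Literature.Analysis.FluidPDE.IsClassicalNSSolutionOn (Set.Icc 0 T₀) ν g w q ∧ Literature.Analysis.FluidPDE.HasUniformRapidDecayOn (Set.Icc 0 T₀) w ∧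 w 0 = 0 ∧ (∫⁻ s in Set.Icc 0 T₀, Literature.Analysis.FluidPDE.eEnergy (g s)) ≤ (a : ENNReal)) ∧ (0 ≤ T₁ ∧ T₀ + T₁ ≤ τ ∧ ∃ (T₂ : ℝ) (v : ℝ → EuclideanSpace ℝ (Fin 3) → EuclideanSpace ℝ (Fin 3)) (pv : ℝ → EuclideanSpace ℝ (Fin 3) → ℝ), T₁ < T₂ ∧ Literature.Analysis.FluidPDE.IsClassicalNSSolutionOn (Set.Ico 0 T₂) ν 0 v pv ∧ Literature.Analysis.FluidPDE.IsLerayHopfOn T₂ ν 0 (w T₀) v ∧ v 0 = w T₀ ∧ v T₁ = u t)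

-- `ReachableAlongFlow` holds: proved by `Summit.NavierStokesRegularity.NavierStokesRegularity.Theorems.quasipotentialCoercivity_reachableAlongFlow_proof` (its module imports this route file, so no `_holds` link can be stated here).

-- item stmt-NavierStokesRegularity-1468 · support · rank 9 · open · by planner — informal only, no Lean statement yet:
--   [support] NEGATIVE COMPANION / BARRIER CALIBRATION (card item (5); informal until a FORCED
--   mild-solution predicate for Tao's averaged equation ∂ₜu = Δu + B̃(u,u) + g exists in Literature —
--   needs_definition: forced H¹⁰/H¹-mild solution of averaged NS, cf.
--   Literature.Analysis.FluidPDE.Tao2016.averagedNS_blowup and IsGlobalH10MildSolution). Claim: for the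
--   averaged bilinear operator B̃ and Schwartz datum u₀ of Tao2016AveragedNS Thm 1.5, the analogue of
--   ActionCoercivityEnstrophy is FALSE: ramp w(s) = φ(s)u₀ on [0,1] with g := ∂ₛw − Δw − B̃(w,w) has
--   finite action, and the unforced B̃-flow from u₀ (t

/-- item stmt-NavierStokesRegularity-17735 · support · rank 9 · closed · proved by Summit.NavierStokesRegularity.NavierStokesRegularity.Theorems.ActionCoercivityEnstrophySplit.quasipotentialCoercivity_actionCoercivityEnstrophyOfTypeSplit_proof (prover) · by planner
sources: Tao2011, CaffarelliKohnNirenberg1982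
[support] GLUE of the Type-I/Type-II split of ActionCoercivityEnstrophy (crux-strategist BC2
redirect, 2026-08-17): ScaledEnergyActionBound → TypeIActionCoercivity → ActionCoercivityEnstrophy
(all three inlined verbatim: child II = stmt-NavierStokesRegularity-17724, child I =
stmt-NavierStokesRegularity-17720, parent = stmt-NavierStokesRegularity-1443). PROVED, sorry-free
(planner file SplitLand.lean attached as evidence on this item and on stmt-1443: lean rc 0, axioms
propext/Classical.choice/Quot.sound, ≈95 tactic lines + 5 lemmas) — a planner cannot write Theorems/
(perm.theorems-prover-only), so ANY PROVER: land SplitLand.lean verbatim as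
Summits/NavierStokesRegularity/NavierStokesRegularity/Theorems/QuasipotentialCoercivityActionCoercivityEnstrophySplit.lean
with --workitem <this item> (it imports no Theses file; the theorem
actionCoercivityEnstrophy_of_subs has exactly this item's type). Content (NOT a one-line seam):
child I needs the Type-I bound along the WHOLE path, child II gives it only for TERMINAL states; the
seam is TRUNCATION CLOSURE of the reachable set — every slice of an admissible path is the terminal
state of an admissible path with the same (ν,τ,a): tail slice -/
@[route_item "route-NavierStokesRegularity-QuasipotentialCoercivity"]
def ActionCoercivityEnstrophyOfTypeSplit : Prop :=
  (∀ ν : ℝ, 0 < ν → ∀ τ : ℝ, 0 < τ → ∀ a : NNReal, ∃ M : NNReal, ∀ x : EuclideanSpace ℝ (Fin 3) → EuclideanSpace ℝ (Fin 3), (∃ (T₀ T₁ : ℝ) (w : ℝ → EuclideanSpace ℝ (Fin 3) → EuclideanSpace ℝ (Fin 3)) (q : ℝ → EuclideanSpace ℝ (Fin 3) → ℝ) (g : ℝ → EuclideanSpace ℝ (Fin 3) → EuclideanSpace ℝ (Fin 3)), (0 < T₀ ∧ Literature.Analysis.FluidPDE.IsClassicalNSSolutionOn (Set.Icc 0 T₀)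 ν g w q ∧ Literature.Analysis.FluidPDE.HasUniformRapidDecayOn (Set.Icc 0 T₀) w ∧ w 0 = 0 ∧ (∫⁻ s in Set.Icc 0 T₀, Literature.Analysis.FluidPDE.eEnergy (g s)) ≤ (a : ENNReal)) ∧ (0 ≤ T₁ ∧ T₀ + T₁ ≤ τ ∧ ∃ (T₂ : ℝ) (v : ℝ → EuclideanSpace ℝ (Fin 3) → EuclideanSpace ℝ (Fin 3)) (pv : ℝ → EuclideanSpace ℝ (Fin 3) → ℝ), T₁ < T₂ ∧ Literature.Analysis.FluidPDE.IsClassicalNSSolutionOn (Set.Ico 0 T₂) ν 0 v pv ∧ Literature.Analysis.FluidPDE.IsLerayHopfOn T₂ ν 0 (w T₀) v ∧ v 0 = w T₀ ∧ v T₁ = x)) → ∀ (y : EuclideanSpace ℝ (Fin 3)) (r : ℝ), 0 < r → (∫⁻ z in Metric.ball y r, ‖x z‖ₑ ^ 2) ≤ (M : ENNReal) * ENNReal.ofReal r) → (∀ ν : ℝ, 0 < ν → ∀ τ : ℝ, 0 < τ → ∀ a : NNReal, ∀ M : NNReal, ∃ C : NNReal, ∀ x : EuclideanSpace ℝ (Fin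 3) → EuclideanSpace ℝ (Fin 3), (∃ (T₀ T₁ : ℝ) (w : ℝ → EuclideanSpace ℝ (Fin 3) → EuclideanSpace ℝ (Fin 3)) (q : ℝ → EuclideanSpace ℝ (Fin 3) → ℝ) (g : ℝ → EuclideanSpace ℝ (Fin 3) → EuclideanSpace ℝ (Fin 3)), (0 < T₀ ∧ Literature.Analysis.FluidPDE.IsClassicalNSSolutionOn (Set.Icc 0 T₀) ν g w q ∧ Literature.Analysis.FluidPDE.HasUniformRapidDecayOn (Set.Icc 0 T₀) w ∧ w 0 = 0 ∧ (∫⁻ s in Set.Icc 0 T₀, Literature.Analysis.FluidPDE.eEnergy (g s)) ≤ (a : ENNReal) ∧ (∀ s ∈ Set.Icc 0 T₀, ∀ (y : EuclideanSpace ℝ (Fin 3)) (r : ℝ), 0 < r → (∫⁻ z in Metric.ball y r, ‖w s z‖ₑ ^ 2) ≤ (M : ENNReal) * ENNReal.ofReal r)) ∧ (0 ≤ T₁ ∧ T₀ + T₁ ≤ τ ∧ ∃ (T₂ : ℝ) (v : ℝ → EuclideanSpace ℝ (Fin 3) → EuclideanSpace ℝ (Fin 3)) (pv : ℝ → EuclideanSpace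 ℝ (Fin 3) → ℝ), T₁ < T₂ ∧ Literature.Analysis.FluidPDE.IsClassicalNSSolutionOn (Set.Ico 0 T₂) ν 0 v pv ∧ Literature.Analysis.FluidPDE.IsLerayHopfOn T₂ ν 0 (w T₀) v ∧ v 0 = w T₀ ∧ v T₁ = x ∧ (∀ s ∈ Set.Icc 0 T₁, ∀ (y : EuclideanSpace ℝ (Fin 3)) (r : ℝ), 0 < r → (∫⁻ z in Metric.ball y r, ‖v s z‖ₑ ^ 2) ≤ (M : ENNReal) * ENNReal.ofReal r))) → (∫⁻ y, ENNReal.ofReal (Literature.Analysis.FluidPDE.frobeniusNormSq (fderiv ℝ x y))) ≤ (C : ENNReal)) → (∀ ν : ℝ, 0 < ν → ∀ τ : ℝ, 0 < τ → ∀ a : NNReal, ∃ C : NNReal, ∀ x : EuclideanSpace ℝ (Fin 3) → EuclideanSpace ℝ (Fin 3), (∃ (T₀ T₁ : ℝ) (w : ℝ → EuclideanSpace ℝ (Fin 3) → EuclideanSpace ℝ (Fin 3)) (q : ℝ → EuclideanSpace ℝ (Fin 3) → ℝ) (g : ℝ → EuclideanSpace ℝ (Fin 3) → EuclideanSpace ℝ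 (Fin 3)), (0 < T₀ ∧ Literature.Analysis.FluidPDE.IsClassicalNSSolutionOn (Set.Icc 0 T₀) ν g w q ∧ Literature.Analysis.FluidPDE.HasUniformRapidDecayOn (Set.Icc 0 T₀) w ∧ w 0 = 0 ∧ (∫⁻ s in Set.Icc 0 T₀, Literature.Analysis.FluidPDE.eEnergy (g s)) ≤ (a : ENNReal)) ∧ (0 ≤ T₁ ∧ T₀ + T₁ ≤ τ ∧ ∃ (T₂ : ℝ) (v : ℝ → EuclideanSpace ℝ (Fin 3) → EuclideanSpace ℝ (Fin 3)) (pv : ℝ → EuclideanSpace ℝ (Fin 3) → ℝ), T₁ < T₂ ∧ Literature.Analysis.FluidPDE.IsClassicalNSSolutionOn (Set.Ico 0 T₂) ν 0 v pv ∧ Literature.Analysis.FluidPDE.IsLerayHopfOn T₂ ν 0 (w T₀) v ∧ v 0 = w T₀ ∧ v T₁ = x)) → (∫⁻ y, ENNReal.ofReal (Literature.Analysis.FluidPDE.frobeniusNormSq (fderiv ℝ x y))) ≤ (C : ENNReal))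

-- `ActionCoercivityEnstrophyOfTypeSplit` holds: proved by `Summit.NavierStokesRegularity.NavierStokesRegularity.Theorems.ActionCoercivityEnstrophySplit.quasipotentialCoercivity_actionCoercivityEnstrophyOfTypeSplit_proof` (its module imports this route file, so no `_holds` link can be stated here).

/-- item stmt-NavierStokesRegularity-1448 · assembly · rank 1 · closed · proved by Summit.NavierStokesRegularity.NavierStokesRegularity.Theorems.quasipotentialCoercivity_assembly_proof (prover) · by planner
sources: Fefferman2000, EscauriazaSereginSverak2003
[assembly] ActionCoercivityL3 → ReachableAlongFlow → L3Closure → NoBlowupToClay →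
NavierStokesRegularity. PURE LOGIC (proved in the planner's Sketch.lean, 8 lines): fix ν,T,u,p as in
NoBlowup; ReachableAlongFlow gives (τ,a) with every slice u(t), t<T, reachable; ActionCoercivityL3
gives C(ν,τ,a), so ⨆_{t∈[0,T)} ‖u(t)‖_{L³} ≤ C < ⊤ (iSup₂_le, ENNReal.coe_lt_top); L3Closure
continues u past T; NoBlowupToClay (= stmt-0055) yields Clay (A). -/
@[route_item "route-NavierStokesRegularity-QuasipotentialCoercivity"]
def Assembly : Prop :=
  (∀ ν : ℝ, 0 < ν → ∀ τ : ℝ, 0 < τ → ∀ a : NNReal, ∃ C : NNReal, ∀ x : EuclideanSpace ℝ (Fin 3) → EuclideanSpace ℝ (Fin 3), (∃ (T₀ T₁ : ℝ) (w : ℝ → EuclideanSpace ℝ (Fin 3) → EuclideanSpace ℝ (Fin 3)) (q : ℝ → EuclideanSpace ℝ (Fin 3) → ℝ) (g : ℝ → EuclideanSpace ℝ (Fin 3) → EuclideanSpace ℝ (Fin 3)), (0 < T₀ ∧ Literature.Analysis.FluidPDE.IsClassicalNSSolutionOn (Set.Icc 0 T₀) ν g w q ∧ Literature.Analysis.FluidPDE.HasUniformRapidDecayOn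 (Set.Icc 0 T₀) w ∧ w 0 = 0 ∧ (∫⁻ s in Set.Icc 0 T₀, Literature.Analysis.FluidPDE.eEnergy (g s)) ≤ (a : ENNReal)) ∧ (0 ≤ T₁ ∧ T₀ + T₁ ≤ τ ∧ ∃ (T₂ : ℝ) (v : ℝ → EuclideanSpace ℝ (Fin 3) → EuclideanSpace ℝ (Fin 3)) (pv : ℝ → EuclideanSpace ℝ (Fin 3) → ℝ), T₁ < T₂ ∧ Literature.Analysis.FluidPDE.IsClassicalNSSolutionOn (Set.Ico 0 T₂) ν 0 v pv ∧ Literature.Analysis.FluidPDE.IsLerayHopfOn T₂ ν 0 (w T₀) v ∧ v 0 = w T₀ ∧ v T₁ = x)) → MeasureTheory.eLpNorm x 3 MeasureTheory.volume ≤ (C : ENNReal)) → (∀ (ν T : ℝ), 0 < ν → 0 < T → ∀ (u : ℝ → EuclideanSpace ℝ (Fin 3) → EuclideanSpace ℝ (Fin 3)) (p : ℝ → EuclideanSpace ℝ (Fin 3) → ℝ), Literature.Analysis.FluidPDE.IsClassicalNSSolutionOn (Set.Ico 0 T) ν 0 u p → Literature.Analysis.FluidPDE.IsLerayHopfOn T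 ν 0 (u 0) u → Literature.Analysis.FluidPDE.HasRapidSpatialDecay (u 0) → ∃ (τ : ℝ) (a : NNReal), 0 < τ ∧ ∀ t ∈ Set.Ico 0 T, ∃ (T₀ T₁ : ℝ) (w : ℝ → EuclideanSpace ℝ (Fin 3) → EuclideanSpace ℝ (Fin 3)) (q : ℝ → EuclideanSpace ℝ (Fin 3) → ℝ) (g : ℝ → EuclideanSpace ℝ (Fin 3) → EuclideanSpace ℝ (Fin 3)), (0 < T₀ ∧ Literature.Analysis.FluidPDE.IsClassicalNSSolutionOn (Set.Icc 0 T₀) ν g w q ∧ Literature.Analysis.FluidPDE.HasUniformRapidDecayOn (Set.Icc 0 T₀) w ∧ w 0 = 0 ∧ (∫⁻ s in Set.Icc 0 T₀, Literature.Analysis.FluidPDE.eEnergy (g s)) ≤ (a : ENNReal)) ∧ (0 ≤ T₁ ∧ T₀ + T₁ ≤ τ ∧ ∃ (T₂ : ℝ) (v : ℝ → EuclideanSpace ℝ (Fin 3) → EuclideanSpace ℝ (Fin 3)) (pv : ℝ → EuclideanSpace ℝ (Fin 3) → ℝ), T₁ < T₂ ∧ Literature.Analysis.FluidPDE.IsClassicalNSSolutionOn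 (Set.Ico 0 T₂) ν 0 v pv ∧ Literature.Analysis.FluidPDE.IsLerayHopfOn T₂ ν 0 (w T₀) v ∧ v 0 = w T₀ ∧ v T₁ = u t)) → (∀ (ν T : ℝ), 0 < ν → 0 < T → ∀ (u : ℝ → EuclideanSpace ℝ (Fin 3) → EuclideanSpace ℝ (Fin 3)) (p : ℝ → EuclideanSpace ℝ (Fin 3) → ℝ), Literature.Analysis.FluidPDE.IsClassicalNSSolutionOn (Set.Ico 0 T) ν 0 u p → Literature.Analysis.FluidPDE.IsLerayHopfOn T ν 0 (u 0) u → Literature.Analysis.FluidPDE.HasRapidSpatialDecay (u 0) → (⨆ t ∈ Set.Ico 0 T, MeasureTheory.eLpNorm (u t) 3 MeasureTheory.volume) < ⊤ → Literature.Analysis.FluidPDE.HasSmoothExtensionPast ν 0 u T) → ((∀ (ν T : ℝ), 0 < ν → 0 < T → ∀ (u : ℝ → EuclideanSpace ℝ (Fin 3) → EuclideanSpace ℝ (Fin 3)) (p : ℝ → EuclideanSpace ℝ (Fin 3) → ℝ), Literature.Analysis.FluidPDE.IsClassicalNSSolutionOn (Set.Ico 0 T) ν 0 u p → Literature.Analysis.FluidPDE.IsLerayHopfOn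 T ν 0 (u 0) u → Literature.Analysis.FluidPDE.HasRapidSpatialDecay (u 0) → Literature.Analysis.FluidPDE.HasSmoothExtensionPast ν 0 u T) → NavierStokesRegularity) → NavierStokesRegularity

-- `Assembly` holds: proved by `Summit.NavierStokesRegularity.NavierStokesRegularity.Theorems.quasipotentialCoercivity_assembly_proof` (its module imports this route file, so no `_holds` link can be stated here).

-- records of items no longer active in this route (dropped / restated):
-- earlier Assembly2 (stmt-NavierStokesRegularity-3530, dropped 2026-08-16T14:43:06Z): moot by None — ∀ (ν T : ℝ), 0 < ν → 0 < T → ∀ (u : ℝ → EuclideanSpace ℝ (Fin 3) → EuclideanSpace ℝ (Fin 3)) (p : ℝ → EuclideanSpace ℝ (Fin 3) → ℝ), Literature.Analysis.FluidPDE.IsClassicalNSSolutionOn (Set.Ico 0 T) ν 0 u p → Literature.Analysis.FluidPDE.IsLerayHopfOn T ν 0 (u 0) u → Literature.Analysis.FluidPDE.Has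

/-! D-0027 §2.1 — DECIDING THEOREM (planner-authored via `route open/edit --closes-file`; by planner-rbadge-NavierStokesRegularity-Quasipot-06b8b513-g4-0 2026-08-16T05:53:52Z):
its hypotheses are this route's items and its conclusion the sub-problem Statement (glue_lint), and it elaborates with this file. -/

@[closes "route-NavierStokesRegularity-QuasipotentialCoercivity"] theorem closes (hZ : ActionCoercivityEnstrophy) : NavierStokesRegularity := by
 /- D-0027 §2.1 (route-repair 2026-08-16 g4): crux X = `ActionCoercivityEnstrophy` ALONE decides Clay (A);
 the ex-supports `ReachableAlongFlow` (ramp `s • u 0` on `[0,1]` + free flow, horizon `T+1`) and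
 `EnstrophyClosure` (Leray H¹ restart near `T` + Serrin weak–strong uniqueness + glue) are proved
 INLINE over proved tree theorems; last step `NoBlowupToClay_holds` (stmt-0055). -/
 refine NoBlowupToClay_holds ?_
 intro ν T hν hT u p hcl hLH hdec
 obtain ⟨C, hZT⟩ : ∃ C : NNReal, ∀ t ∈ Set.Ico 0 T, (∫⁻ y, ENNReal.ofReal
   (Literature.Analysis.FluidPDE.frobeniusNormSq (fderiv ℝ (u t) y))) ≤ (C : ENNReal) := by
  have h0T : (0 : ℝ) ∈ Set.Ico 0 T := ⟨le_rfl, hT⟩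
  have hu₀ : ContDiff ℝ ((⊤ : ℕ∞) : WithTop ℕ∞) (u 0) := hcl.contDiff_velocity h0T
  have hd0 : Differentiable ℝ (u 0) := hu₀.differentiable (by simp)
  set S : Set ℝ := Set.Icc (0 : ℝ) 1 with hS
  set w := fun (s : ℝ) x => s • u 0 x with hw
  set q := fun (_ : ℝ) => Function.const (EuclideanSpace ℝ (Fin 3)) (0 : ℝ)
  set g := fun s x => derivWithin (fun r => w r x) S s + fderiv ℝ (w s) x (w s x)
    - ν • Laplacian.laplacian (w s) x with hg
  have hwsol : Literature.Analysis.FluidPDE.IsClassicalNSSolutionOn S ν g w q := by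
    refine ⟨(contDiff_fst.smul (hu₀.comp contDiff_snd)).contDiffOn, contDiffOn_const, ?_, ?_⟩
    · intro t _ x
      rw [show gradient (q t) x = 0 from gradient_const x (0 : ℝ), sub_zero]
      simp only [hg, Literature.Analysis.FluidPDE.timeDerivWithin_apply,
        Literature.Analysis.FluidPDE.convect_apply]
      abel
    · intro t _ x
      have h0 := hcl.divFree 0 h0T x
      unfold Literature.Analysis.FluidPDE.VectorCalculus.divergence at h0 ⊢
      rw [show w t = fun x => t • u 0 x from rfl, fderiv_fun_const_smul (hd0 x),
        ContinuousLinearMap.toLinearMap_smul, map_smul, h0, smul_zero]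
  have hwdec : Literature.Analysis.FluidPDE.HasUniformRapidDecayOn S w := by
    intro n K
    choose Cd hCd using hdec
    refine ⟨∑ i ∈ Finset.range (n + 1), (n.choose i : ℝ) * (1 * Cd (n - i) K), fun t ht x => ?_⟩
    have hF : ContDiff ℝ ((⊤ : ℕ∞) : WithTop ℕ∞) (fun y : ℝ × _ => Prod.fst y • (u 0 ∘ Prod.snd) y) :=
      contDiff_fst.smul (hu₀.comp contDiff_snd)
    rw [show Function.uncurry w = fun y => Prod.fst y • (u 0 ∘ Prod.snd) y from rfl,
      iteratedFDerivWithin_eq_iteratedFDeriv ((uniqueDiffOn_Icc zero_lt_one).prod uniqueDiffOn_univ)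
      (hF.contDiffAt.of_le (by exact_mod_cast le_top)) (Set.mk_mem_prod ht (Set.mem_univ x))]
    have hfst : ∀ i : ℕ, ‖iteratedFDeriv ℝ i (Prod.fst : ℝ × EuclideanSpace ℝ (Fin 3) → ℝ) (t, x)‖ ≤ 1 := by
      intro i
      rcases i with _ | i
      · rw [norm_iteratedFDeriv_zero, Real.norm_eq_abs, abs_le]
        exact ⟨by linarith [ht.1], ht.2⟩
      rw [← norm_iteratedFDeriv_fderiv, show fderiv ℝ (Prod.fst : ℝ × EuclideanSpace ℝ (Fin 3) → ℝ) =
        fun _ => ContinuousLinearMap.fst ℝ ℝ _ from funext fun _ => fderiv_fst]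
      rcases i with _ | i
      · rw [norm_iteratedFDeriv_zero]
        exact ContinuousLinearMap.norm_fst_le ..
      rw [iteratedFDeriv_const_of_ne (by omega)]
      simp
    have hsnd : ∀ j : ℕ, ‖iteratedFDeriv ℝ j (u 0 ∘ Prod.snd) (t, x)‖ ≤ ‖iteratedFDeriv ℝ j (u 0) x‖ := by
      intro j
      rw [show u 0 ∘ Prod.snd = u 0 ∘ ⇑(ContinuousLinearMap.snd ℝ ℝ (EuclideanSpace ℝ (Fin 3))) from rfl,
        ContinuousLinearMap.iteratedFDeriv_comp_right _ hu₀ _ (by exact_mod_cast le_top)]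
      exact (ContinuousMultilinearMap.norm_compContinuousLinearMap_le _ _).trans (by simp)
    refine (mul_le_mul_of_nonneg_left (norm_iteratedFDeriv_smul_le contDiff_fst (hu₀.comp contDiff_snd)
      (t, x) (n := n) (by exact_mod_cast le_top)) (by positivity)).trans ?_
    rw [Finset.mul_sum]
    refine Finset.sum_le_sum fun i _ => (le_of_eq (by ring)).trans (mul_le_mul_of_nonneg_left (mul_le_mul
      (hfst i) ((mul_le_mul_of_nonneg_left (hsnd (n - i)) (by positivity : (0 : ℝ) ≤ (1 + ‖x‖) ^ K)).trans
      (hCd (n - i) K x)) (by positivity) zero_le_one) (Nat.cast_nonneg _))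
  obtain ⟨C0, hC0⟩ := hdec 0 2
  obtain ⟨C1, hC1⟩ := hdec 1 0
  obtain ⟨C2, hC2⟩ := hdec 2 2
  have hC1nn : 0 ≤ C1 := le_trans (by positivity) (hC1 0)
  set Kg : ℝ := C0 + C1 * C0 + ν * (3 * C2)
  have hgpt : ∀ s ∈ S, ∀ x, ‖g s x‖ ≤ Kg * ((1 + ‖x‖) ^ 2)⁻¹ := by
    intro s hs x
    have hx2 : 0 < (1 + ‖x‖) ^ 2 := by positivity
    have hs1 : |s| ≤ 1 := abs_le.2 ⟨by linarith [hs.1], hs.2⟩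
    have h1 : derivWithin (fun r => w r x) S s = u 0 x := by
      rw [show (fun r => w r x) = fun r => r • u 0 x from rfl, (((hasDerivAt_id' s).smul_const
        (u 0 x)).hasDerivWithinAt (s := S)).derivWithin (uniqueDiffOn_Icc zero_lt_one s hs), one_smul]
    have h2 : fderiv ℝ (w s) x (w s x) = s • (s • (fderiv ℝ (u 0) x) (u 0 x)) := by
      rw [show w s = fun y => s • u 0 y from rfl, fderiv_fun_const_smul (hd0 x)]
      simp only [FunLike.coe_smul, Pi.smul_apply, map_smul]
    have h3 : Laplacian.laplacian (w s) x = s • Laplacian.laplacian (u 0) x :=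
      InnerProductSpace.laplacian_smul s (hu₀.contDiffAt.of_le (by norm_cast))
    have hn0 : ‖u 0 x‖ ≤ C0 * ((1 + ‖x‖) ^ 2)⁻¹ := by
      have := hC0 x
      rw [norm_iteratedFDeriv_zero] at this
      rw [le_mul_inv_iff₀ hx2]
      linarith [mul_comm ((1 + ‖x‖) ^ 2) ‖u 0 x‖]
    have hn1 : ‖fderiv ℝ (u 0) x‖ ≤ C1 := by
      have := hC1 x
      rwa [pow_zero, one_mul, show ‖iteratedFDeriv ℝ 1 (u 0) x‖ = ‖fderiv ℝ (u 0) x‖ by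
        rw [← norm_iteratedFDeriv_zero (𝕜 := ℝ) (f := fderiv ℝ (u 0)), norm_iteratedFDeriv_fderiv]] at this
    have hn2 : ‖Laplacian.laplacian (u 0) x‖ ≤ 3 * (C2 * ((1 + ‖x‖) ^ 2)⁻¹) := by
      have h22 : ‖iteratedFDeriv ℝ 2 (u 0) x‖ ≤ C2 * ((1 + ‖x‖) ^ 2)⁻¹ := by
        rw [le_mul_inv_iff₀ hx2]
        linarith [hC2 x, mul_comm ((1 + ‖x‖) ^ 2) ‖iteratedFDeriv ℝ 2 (u 0) x‖]
      rw [InnerProductSpace.laplacian_eq_iteratedFDeriv_orthonormalBasis (u 0) (EuclideanSpace.basisFun (Fin 3) ℝ)]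
      refine (norm_sum_le _ _).trans ((Finset.sum_le_sum fun i _ =>
        (ContinuousMultilinearMap.le_opNorm _ _).trans (?_ : _ ≤ C2 * ((1 + ‖x‖) ^ 2)⁻¹)).trans (by simp))
      rw [Fin.prod_univ_two]
      simpa using h22
    have hA : ‖s • (s • (fderiv ℝ (u 0) x) (u 0 x))‖ ≤ C1 * (C0 * ((1 + ‖x‖) ^ 2)⁻¹) := by
      rw [norm_smul, norm_smul, Real.norm_eq_abs]
      calc |s| * (|s| * ‖(fderiv ℝ (u 0) x) (u 0 x)‖) ≤ 1 * (1 * ‖(fderiv ℝ (u 0) x) (u 0 x)‖) := by gcongr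
        _ ≤ 1 * (1 * (‖fderiv ℝ (u 0) x‖ * ‖u 0 x‖)) := by gcongr; exact ContinuousLinearMap.le_opNorm _ _
        _ ≤ 1 * (1 * (C1 * (C0 * ((1 + ‖x‖) ^ 2)⁻¹))) := by gcongr
        _ = _ := by ring
    have hB : ‖ν • (s • Laplacian.laplacian (u 0) x)‖ ≤ ν * (3 * (C2 * ((1 + ‖x‖) ^ 2)⁻¹)) := by
      rw [norm_smul, norm_smul, Real.norm_eq_abs, Real.norm_eq_abs, abs_of_pos hν]
      calc ν * (|s| * ‖Laplacian.laplacian (u 0) x‖) ≤ ν * (1 * ‖Laplacian.laplacian (u 0) x‖) := by gcongr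
        _ ≤ ν * (1 * (3 * (C2 * ((1 + ‖x‖) ^ 2)⁻¹))) := by gcongr
        _ = _ := by ring
    calc ‖g s x‖ = ‖u 0 x + s • (s • (fderiv ℝ (u 0) x) (u 0 x)) - ν • (s • Laplacian.laplacian (u 0) x)‖ := by
          simp only [hg]
          rw [h1, h2, h3]
      _ ≤ ‖u 0 x‖ + ‖s • (s • (fderiv ℝ (u 0) x) (u 0 x))‖ + ‖ν • (s • Laplacian.laplacian (u 0) x)‖ :=
          (norm_sub_le _ _).trans (by gcongr; exact norm_add_le _ _)
      _ ≤ C0 * ((1 + ‖x‖) ^ 2)⁻¹ + C1 * (C0 * ((1 + ‖x‖) ^ 2)⁻¹) + ν * (3 * (C2 * ((1 + ‖x‖) ^ 2)⁻¹)) := by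
          gcongr
      _ = _ := by ring
  have hvol : (∫⁻ y : EuclideanSpace ℝ (Fin 3), ENNReal.ofReal ((1 + ‖y‖) ^ (-(4 : ℝ)))) < ⊤ :=
    finite_integral_one_add_norm (by rw [finrank_euclideanSpace_fin]; norm_num)
  set B : ENNReal := ENNReal.ofReal (Kg ^ 2) * ∫⁻ y : EuclideanSpace ℝ (Fin 3), ENNReal.ofReal ((1 + ‖y‖) ^ (-(4 : ℝ)))
  have hBtop : B < ⊤ := ENNReal.mul_lt_top ENNReal.ofReal_lt_top hvol
  have hEg : ∀ s ∈ S, (∫⁻ x, ‖g s x‖ₑ ^ 2) ≤ B := by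
    intro s hs
    refine (MeasureTheory.lintegral_mono fun x => ?_).trans
      (le_of_eq (MeasureTheory.lintegral_const_mul' _ _ ENNReal.ofReal_ne_top))
    rw [← ofReal_norm, ← ENNReal.ofReal_pow (norm_nonneg _), ← ENNReal.ofReal_mul (sq_nonneg _)]
    refine ENNReal.ofReal_le_ofReal ((pow_le_pow_left₀ (norm_nonneg _) (hgpt s hs x) 2).trans_eq ?_)
    rw [Real.rpow_neg (by positivity), show (4 : ℝ) = ((4 : ℕ) : ℝ) by norm_num, Real.rpow_natCast]
    field_simp
  have ha : (∫⁻ s in S, ∫⁻ x, ‖g s x‖ₑ ^ 2) ≤ ((B.toNNReal : NNReal) : ENNReal) := by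
    rw [ENNReal.coe_toNNReal hBtop.ne]
    exact (MeasureTheory.setLIntegral_mono measurable_const hEg).trans
      (by rw [MeasureTheory.setLIntegral_const, hS, Real.volume_Icc]; simp)
  obtain ⟨C, hC⟩ := hZ ν hν (T + 1) (by linarith) B.toNNReal
  refine ⟨C, fun t ht => hC (u t) ?_⟩
  have hw1 : w 1 = u 0 := funext fun x => by simp [hw]
  exact ⟨1, t, w, q, g, ⟨one_pos, hwsol, hwdec, funext fun x => by simp [hw], ha⟩,
    ⟨ht.1, by linarith [ht.2], T, u, p, ht.2, hcl, hw1 ▸ hLH, hw1.symm, rfl⟩⟩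
 -- Step 2: H¹ continuation past `T` from the uniform enstrophy bound `C`
 obtain ⟨c₀, hc₀, hpack⟩ := Literature.Analysis.FluidPDE.leray_local_regular_H1_holds
 set A : ℝ := (C : ℝ) + 1 with hAdef
 set d : ℝ := c₀ * ν ^ 3 / (A ^ 2 + 1) with hddef
 have hd : 0 < d := by positivity
 have hAd : A ^ 2 * d ≤ c₀ * ν ^ 3 := by
  rw [hddef, mul_div_assoc', div_le_iff₀ (by positivity)]
  nlinarith [sq_nonneg A, mul_pos hc₀ (pow_pos hν 3)]
 have hlo0 : (0 : ℝ) ≤ max 0 (T - d / 2) := le_max_left _ _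
 obtain ⟨s, hs, hLHs⟩ := hLH.exists_isLerayHopfOn_restart_Ioo hν.le hlo0 (max_lt hT (by linarith)) le_rfl
 have hs0 : 0 < s := lt_of_le_of_lt hlo0 hs.1
 have hsd : T - d / 2 < s := (le_max_right _ _).trans_lt hs.1
 have hsT : s < T := hs.2
 have hsI : s ∈ Set.Ico 0 T := ⟨hs0.le, hsT⟩
 have hu2 : MeasureTheory.MemLp (u s) 2 := hLH.memLp s ⟨hs0.le, hsT.le⟩
 obtain ⟨v, pv, hv, -, hvreg, hns, -⟩ := hpack hν hd hu2 (hLHs.isWeaklyDivFree_datum (by linarith))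
  (by positivity : 0 ≤ A) (by
   rw [Literature.Analysis.FluidPDE.eWeakGradL2Sq_eq_of_hasWeakGradient
    (Literature.Analysis.FluidPDE.hasWeakGradient_fderiv_of_contDiff ((hcl.contDiff_velocity hsI).of_le
    (by norm_cast)))]
   exact (hZT s hsI).trans (ENNReal.ofReal_coe_nnreal.symm.trans_le
    (ENNReal.ofReal_le_ofReal (by rw [hAdef]; linarith)))) hAd
 set d' : ℝ := min d (T - s)
 have hd' : 0 < d' := lt_min hd (by linarith)
 have hqr : 2 / (⊤ : ENNReal) + 3 / 6 ≤ 1 := by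
  rw [ENNReal.div_top, zero_add]
  exact ENNReal.div_le_of_le_mul (by norm_num)
 have hae : ∀ τ ∈ Set.Ioc 0 d', u (τ + s) =ᵐ[MeasureTheory.volume] v τ := fun τ hτ =>
  Literature.Analysis.FluidPDE.serrin_weak_strong_uniqueness_holds hν hd' (hv.of_le (min_le_left _ _)) hu2
   (q := ⊤) (r := 6) (by norm_num) hqr ((Literature.Analysis.FluidPDE.memLqLp_top_six_of_isH1RegularOn_Icc
    hvreg fun τ hτ => hv.memLp τ hτ).mono_set (Set.Ioo_subset_Ioo_right (min_le_left _ _)))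
   (hLHs.of_le (min_le_right _ _)) τ hτ
 have hns' := (hns.comp_add_right (-s)).mono (S' := Set.Ioo (s + (T - s) / 2) (s + d))
  (fun t ht => ⟨by simp only; linarith [ht.1], by simp only; linarith [ht.2]⟩) (uniqueDiffOn_Ioo _ _)
 have hagree : ∀ t ∈ Set.Ioo (s + (T - s) / 2) T, u t = v (t + -s) := by
  intro t ht
  have htd : t + -s ∈ Set.Ioc 0 d' := ⟨by linarith [ht.1], le_min (by linarith [ht.2]) (by linarith [ht.2])⟩
  have h1 := hae (t + -s) htd
  rw [show t + -s + s = t by ring] at h1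
  exact Literature.Analysis.FluidPDE.eq_of_ae_eq_of_continuous (hcl.contDiff_velocity
   ⟨by linarith [ht.1], ht.2⟩).continuous (hns.contDiff_velocity ⟨htd.1, htd.2.trans (min_le_left _ _)⟩).continuous h1
 exact ⟨s + d, by linarith, _, _, hcl.glue hns' (by linarith) (by linarith) (by linarith) hagree,
  fun t ht => by simp only [ht.2, if_true]⟩

end Summit.NavierStokesRegularity.NavierStokesRegularity.Theses.QuasipotentialCoercivity
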